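import Summits.HodgeConjecture.HodgeConjecture.Theorems.K2E1bDSClsOfRecord          -- ★ Q9c p856729: `dsClsOfRecord(_of_regular)`, `dsCellRep` (over ★ #23 `σOfRecord`, ★ U8-3 `dsCellDatum` + LAWS, ★ `sum_lie_lie_eq_casimir`)
import Summits.HodgeConjecture.HodgeConjecture.Theorems.K2E1bCubicCasimirCentral     -- ★ U8-4c-A p856845: `hasCubicPin_mk_iff` (over ★ D-U8-1 `upqCubicOp`, `HasCubicScalar`, `HasCubicPin`, `cubicOf`)
import Summits.HodgeConjecture.HodgeConjecture.Theorems.K2E1bTwistChiScalars        -- ★ U0 #7: `twistChiScalars`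
import Literature.RepresentationTheory.Kovacevic2021.SU21UnitarityCriterion         -- ★ `vec_apply_mk`
import Literature.RepresentationTheory.Kovacevic2021.SU21CasimirIrreducible         -- ★ `exists_casimir_eq_smul_one_of_isIrreducible`, `nonempty_S_of_isIrreducible`
import HarnessLib

/-!
# K2 ∕ E1b unit U8, brick 8b-β (part 1 of 2) `K2E1bDatumCubicScalar`: THE CUBIC GELFAND SCALAR OF THE STRUCTURE OF RECORD OF A
# KOVAČEVIĆ DATUM — twist dictionary, the value on `u¹_{n,m}`, the vertex packages, χ ⇒ Casimir scalar, and the calibration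
# `HasCubicPin (dsClsOfRecord a b c j) s → s = cubicOf a b c`

HCML Track B «K2-LIT», cell `hodgecm-mathlib`, crux H413 = stmt-HodgeConjecture-24833 (supports-only helper; closes nothing by itself).  Brick **8b-β**
«datum-level unitary dual at regular χ» of the TABLE `Lines/K2_E1b_GKCohomologyU21_U8_ArchPacketSigns.md` ED. 8 §2d, DEAL K2E1b-plan (g3) → K2E4-p10 (g3)
2026-09-04T03:13:37Z (`Theorems/K2E1bDatumUnitaryDual.lean :: datumUnitaryDual_at_regular`; this file is its computational half, split for the 400-line lint).
THEOREMS ONLY (no `def`, no `sorry`, no instance declaration — one `attribute [local instance] LieRing.ofAssociativeRing`, the idiom of every ★ Kovačević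
file —, no notation).

## What is proved

* §1 **TWIST DICTIONARY** (`upqLieC_σOfRecord`, `upqLieC_σOfRecord_single`): the complexified action (★ `upqLieC`) of the central twist of record
  `σOfRecord 𝒟 e = kovLie 𝒟.ρ + (e∕3)·tr(·)·1` (★ #23) is `M ↦ ρ(M̃) + (e∕3) tr(M)·1` (`M̃` = `M` reindexed along `Fin 2 ⊕ Fin 1 ≃ Fin 3`); on matrix units
  `E_{ij} ↦ ρ(E_{ĩj̃}) + δ_{ij} (e∕3)·1`.
* §2 **THE CUBIC GELFAND ELEMENT ON `u¹_{n,m}`** (`cubicScalar_ofRecord_eq`, the cubic twin of ★ `casimir_vec` ∕ ★ `casimirScalar`): if `C₃ = Σ E_{ij}E_{jk}E_{ki}`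
  (★ `upqCubicOp`) acts on the structure of record by the scalar `s` (★ `HasCubicScalar`), then for every `K`-type `(n,m) ∈ S`
  `s = −1∕2 − m∕4 − m³∕36 + n²∕2 + mn²∕4 + A D′·(n+1)(n+3−m)∕2 + B C′·(2+n−n²) + A″D·(n²+n−2) + B″C·(−3∕2 + m∕2 + 2n − n²∕2 − mn∕2) + e·c_{n,m} + e³∕9`
  (`A D′ = A_{n,m}D_{n+1,m+3}`, `B C′ = B_{n,m}C_{n+1,m−3}` the upward invariant products, `A″D = A_{n−1,m−3}D_{n,m}`, `B″C = B_{n−1,m+3}C_{n,m}` the downward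
  ones, `c_{n,m}` = ★ `casimirScalar`; the `e`-terms are `3·(e∕3)·C₂ + 3·(e∕3)²·ρ(1) + 3(e∕3)³` with `ρ(1) = 0`) — the `u¹_{n,m}`-coefficient of the 27 words,
  read by ★ `vec_apply_mk` (kernel-checked `simp` expansion of ★ `Ha_vec` … `Yb_vec`).
* §3 **VERTEX PACKAGES**: at a level-one `K`-type `(1,m)` (`cubicScalar_ofRecord_levelOne`: `A D′`, `B C′` and `s` in terms of `m`, `c_{1,m}`, `e` — (b20) and
  the Casimir) and at a LOCAL MINIMUM `(n,m)`, `n ≥ 2` (`localMin_package`: `(n+1)·A D′ = −(n+m+1)∕2`, `(n+1)·B C′ = −(n−m+1)∕2` from (b20)(b25),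
  `c_{n,m} = (n²−1)∕2 + m²∕6 − (n+1)` and `36 s = −81 + 9m + 9m² − m³ − 54n + 27n² − 18mn + 9mn² + 36e·c_{n,m} + 4e³`).
* §4 **χ ⇒ CASIMIR SCALAR** (`casimirScalar_eq_of_hasChiScalars`): for an irreducible datum, ★ `HasChiScalars (σOfRecord 𝒟 e) κ e` forces `c_{n,m} = κ − e²∕3` on `S`
  (★ `exists_casimir_eq_smul_one_of_isIrreducible`, ★ `twistChiScalars` forward, comparison on a basis vector).
* §5 **CALIBRATION OF THE RECORD CELLS** (`eq_cubicOf_of_hasCubicPin_dsClsOfRecord`): at a regular parameter, `HasCubicPin (dsClsOfRecord a b c j) s → s = cubicOf a b c`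
  for `j = 0, 1, 2` (★ `dsClsOfRecord_of_regular` + ★ `hasCubicPin_mk_iff` move the pin onto the record of ★ `dsCellDatum j a b c`; §3 at its vertex ★
  `dsCellDatum_vertex_zero` ∕ `dsCellDatum_coneVertex_one∕two` with ★ `dsCellDatum_casimirScalar`; then `ring`) — the uniqueness half of the LAWS row U8-4c (iii),
  confirming the Perelomov–Popov closed form ★ `cubicOf` on all three cells (no outer-automorphism twist in the record realisation).

Sources: [Kovacevic2021] §3 Def. 1, Thm 1–2 (the action and the relations (b20)–(b45)), Remark 3; [Molev2007] §7.1 (Gelfand invariants, centrality);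
[Iachello2015] §7.4 (7.20)–(7.24) (Perelomov–Popov eigenvalues); [Rogawski1990] §12.3 pp. 176–178; [KnappVogan1995] Prop. 4.120.
HONEST LABEL: 8b-β is one of the bricks of socket 8b (`UnitaryDualWith`); this file closes nothing by itself; HC_CM is proved only modulo the 7 printed
citations (2 remaining named inputs: hLiu418 = stmt-HodgeConjecture-24832, h413 = stmt-HodgeConjecture-24833) until rung 0 closes.
-/

set_option autoImplicit false
set_option linter.dupNamespace false

noncomputable section

namespace Summit.HodgeConjecture.HodgeConjecture.Cruxes.H413.K2E1bDatumCubicScalar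

open Literature.NumberTheory.Automorphic
open Literature.RepresentationTheory
open Literature.RepresentationTheory.BorelWallach2000
open Literature.RepresentationTheory.KonnoKonno2007 Literature.RepresentationTheory.KonnoKonno2007.RealDualPair
open Literature.RepresentationTheory.KonnoKonno2007.RealDualPair.UForm
open Literature.RepresentationTheory.Kovacevic2021 Literature.RepresentationTheory.Kovacevic2021.SU21Datum
open Summit.HodgeConjecture.HodgeConjecture.Cruxes.H413.F0P3bLocalAPacketsDefs
open Summit.HodgeConjecture.HodgeConjecture.Cruxes.H413.F0P3bU21Restriction
open Summit.HodgeConjecture.HodgeConjecture.Cruxes.H413.K2E1bGKCohomologyU21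
open Summit.HodgeConjecture.HodgeConjecture.Cruxes.H413.K2E1bGKCohomologyU21.U8 (IsRegularParam casimirOf centralOf)
open Summit.HodgeConjecture.HodgeConjecture.Cruxes.H413.K2E1bGKCohomologyU21.U8.LevelB
open Summit.HodgeConjecture.HodgeConjecture.Cruxes.H413.K2E1bDsDatum (sum_lie_lie_eq_casimir)
open Summit.HodgeConjecture.HodgeConjecture.Cruxes.H413.K2E1bCarriersOfRecord
open Summit.HodgeConjecture.HodgeConjecture.Cruxes.H413.K2E1bDSCellData
open Summit.HodgeConjecture.HodgeConjecture.Cruxes.H413.K2E1bDSClsOfRecord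

-- Mathlib idiom (Mathlib/Algebra/Lie/OfAssociative.lean): commutator brackets on associative algebras; needed to MENTION `σOfRecord 𝒟 e : 𝔲(2,1) →ₗ⁅ℝ⁆ End V`
-- and the `𝔤𝔩(3,ℂ)`-module `𝒟.V`, exactly as in every ★ Kovačević file, ★ `K2E1bCarriersOfRecord`, ★ `K2E1bCubicCasimirDefs`.
attribute [local instance 100] LieRing.ofAssociativeRing

/-! ## §1 The twist dictionary -/

/-- **TWIST DICTIONARY.**  The complexified action of the central twist of record is `ρ_ℂ(M) = ρ(M̃) + (e∕3)·tr(M)·1` (`M̃` = `M` reindexed along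
`Fin 2 ⊕ Fin 1 ≃ Fin 3`): `σ = kovLie ρ + (e∕3) tr` (★ `σOfRecord_isTwistOf`), `ρ_ℂ(M) = σ(Re M) + i σ(Im M)` (★ `upqLieC_apply`), `M = Re M + i Im M`
(★ `coe_upqRePart_add_I_smul_coe_upqImPart`) and `ρ`, `tr` are `ℂ`-linear. [cite: Knapp2002, VI §2] [cite: KnappVogan1995, Prop. 4.120] -/
theorem upqLieC_σOfRecord (𝒟 : SU21Datum) (e : ℤ) (M : Matrix (Fin 2 ⊕ Fin 1) (Fin 2 ⊕ Fin 1) ℂ) :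
    upqLieC (σOfRecord 𝒟 e) M =
      𝒟.ρfun (Matrix.reindex (finSumFinEquiv : Fin 2 ⊕ Fin 1 ≃ Fin 3) (finSumFinEquiv : Fin 2 ⊕ Fin 1 ≃ Fin 3) M) +
        (((e : ℂ) / 3) * M.trace) • (1 : Module.End ℂ 𝒟.V) := by
  have hσ : ∀ X : G21.lie, σOfRecord 𝒟 e X =
      𝒟.ρ (Matrix.reindex (finSumFinEquiv : Fin 2 ⊕ Fin 1 ≃ Fin 3) (finSumFinEquiv : Fin 2 ⊕ Fin 1 ≃ Fin 3)
        (X : Matrix (Fin 2 ⊕ Fin 1) (Fin 2 ⊕ Fin 1) ℂ)) +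
        (((e : ℂ) / 3) * (X : Matrix (Fin 2 ⊕ Fin 1) (Fin 2 ⊕ Fin 1) ℂ).trace) • (1 : Module.End ℂ 𝒟.V) := fun X => by
    rw [σOfRecord_isTwistOf 𝒟 e X, kovLie_apply]
  rw [upqLieC_apply, hσ, hσ, ← ρ_apply]
  conv_rhs => rw [← coe_upqRePart_add_I_smul_coe_upqImPart M]
  simp only [Matrix.reindex_apply, Matrix.submatrix_add, Matrix.submatrix_smul, Pi.add_apply, Pi.smul_apply, map_add,
    map_smul, Matrix.trace_add, Matrix.trace_smul, smul_eq_mul, smul_add, smul_smul, mul_add, add_smul]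
  have : ((e : ℂ) / 3 * (Complex.I * ((upqImPart (Fin 2) (Fin 1) M : G21.lie) : Matrix (Fin 2 ⊕ Fin 1) (Fin 2 ⊕ Fin 1) ℂ).trace)) =
      Complex.I * ((e : ℂ) / 3 * ((upqImPart (Fin 2) (Fin 1) M : G21.lie) : Matrix (Fin 2 ⊕ Fin 1) (Fin 2 ⊕ Fin 1) ℂ).trace) := by ring
  rw [this]
  abel

/-- The index dictionary `Fin 2 ⊕ Fin 1 ≃ Fin 3`: `inl 0 ↦ 0`. [folklore] -/
theorem finSumFinEquiv_inl_zero : (finSumFinEquiv : Fin 2 ⊕ Fin 1 ≃ Fin 3) (Sum.inl 0) = 0 := by decide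

/-- The index dictionary: `inl 1 ↦ 1`. [folklore] -/
theorem finSumFinEquiv_inl_one : (finSumFinEquiv : Fin 2 ⊕ Fin 1 ≃ Fin 3) (Sum.inl 1) = 1 := by decide

/-- The index dictionary: `inr 0 ↦ 2`. [folklore] -/
theorem finSumFinEquiv_inr_zero : (finSumFinEquiv : Fin 2 ⊕ Fin 1 ≃ Fin 3) (Sum.inr 0) = 2 := by decide

/-- **Twist dictionary on matrix units**: `ρ_ℂ(E_{ij}) = ρ(E_{ĩj̃}) + δ_{ij}·(e∕3)·1`. [cite: KnappVogan1995, Prop. 4.120] [cite: Kovacevic2021, §3] -/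
theorem upqLieC_σOfRecord_single (𝒟 : SU21Datum) (e : ℤ) (i j : Fin 2 ⊕ Fin 1) :
    upqLieC (σOfRecord 𝒟 e) (Matrix.single i j (1 : ℂ)) =
      𝒟.ρfun (E ((finSumFinEquiv : Fin 2 ⊕ Fin 1 ≃ Fin 3) i) ((finSumFinEquiv : Fin 2 ⊕ Fin 1 ≃ Fin 3) j)) +
        (if i = j then (e : ℂ) / 3 else 0) • (1 : Module.End ℂ 𝒟.V) := by
  rw [upqLieC_σOfRecord, Matrix.reindex_apply, Matrix.submatrix_single_equiv, Equiv.symm_symm]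
  congr 2
  by_cases h : i = j
  · subst h; rw [if_pos rfl, Matrix.trace_single_eq_same, mul_one]
  · rw [if_neg h, Matrix.trace_single_eq_of_ne _ _ _ h, mul_zero]

/-! ## §2 The cubic Gelfand element of the structure of record on `u¹_{n,m}` -/

-- One fixed `simp` expansion of the 27 words `E_{ij}E_{jk}E_{ki}` on `u¹_{n,m}` through ★ `Ha_vec` … `Yb_vec`, then the `u¹_{n,m}`-coefficient
-- by ★ `vec_apply_mk` (labels compared by `omega`); the term is large, whence the two raised limits for this one declaration.
set_option maxHeartbeats 4000000 in
set_option maxRecDepth 30000 in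
/-- **THE CUBIC GELFAND SCALAR ON `u¹_{n,m}`.**  If `C₃ = Σ_{i,j,k} E_{ij}E_{jk}E_{ki}` (through the complexified action of the structure of record,
★ `upqCubicOp`) acts by the scalar `s`, then at every `K`-type `(n, m)`:
`s = −1∕2 − m∕4 − m³∕36 + n²∕2 + mn²∕4 + A_{n,m}D_{n+1,m+3}·(n+1)(n+3−m)∕2 + B_{n,m}C_{n+1,m−3}·(2+n−n²) + A_{n−1,m−3}D_{n,m}·(n²+n−2)
 + B_{n−1,m+3}C_{n,m}·(−3∕2 + m∕2 + 2n − n²∕2 − mn∕2) + e·c_{n,m} + e³∕9` — the coefficient of `u¹_{n,m}` in `C₃ u¹_{n,m}` (only closed 3-step paths in the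
`K`-type lattice contribute: no `𝔭`-step, or one up-and-back pair through `(n±1, m±3)`, with one `𝔨`-step), plus the twist terms `e·C₂ + e³∕9` (§1).
[cite: Kovacevic2021, §3 Def. 1, Thm 1, Thm 2] [cite: Molev2007, §7.1] [cite: Iachello2015, (7.4), (7.24)] -/
theorem cubicScalar_ofRecord_eq (𝒟 : SU21Datum) (e : ℤ) {s : ℂ} (hs : HasCubicScalar (σOfRecord 𝒟 e) s) {n m : ℤ}
    (hS : (n, m) ∈ 𝒟.S) :
    s = -1 / 2 - (m : ℂ) / 4 - (m : ℂ) ^ 3 / 36 + (n : ℂ) ^ 2 / 2 + (m : ℂ) * (n : ℂ) ^ 2 / 4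
      + 𝒟.A n m * 𝒟.D (n + 1) (m + 3) * (((n : ℂ) + 1) * ((n : ℂ) + 3 - m) / 2)
      + 𝒟.B n m * 𝒟.C (n + 1) (m - 3) * (2 + (n : ℂ) - (n : ℂ) ^ 2)
      + 𝒟.A (n - 1) (m - 3) * 𝒟.D n m * ((n : ℂ) ^ 2 + n - 2)
      + 𝒟.B (n - 1) (m + 3) * 𝒟.C n m * (-3 / 2 + (m : ℂ) / 2 + 2 * n - (n : ℂ) ^ 2 / 2 - (m : ℂ) * n / 2)
      + (e : ℂ) * 𝒟.casimirScalar n m + (e : ℂ) ^ 3 / 9 := by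
  have h1 : (n, m) ∈ 𝒟.S ∧ (1 : ℤ) ≤ 1 ∧ 1 ≤ n := ⟨hS, le_rfl, 𝒟.one_le_of_mem hS⟩
  have h := hs (𝒟.vec n m 1)
  rw [upqCubicOp_apply] at h
  simp only [Fintype.sum_sum_type, Fin.sum_univ_two, Fin.sum_univ_one, Fin.isValue, upqLieC_σOfRecord_single,
    finSumFinEquiv_inl_zero, finSumFinEquiv_inl_one, finSumFinEquiv_inr_zero, Sum.inl.injEq, Sum.inr.injEq,
    reduceCtorEq, if_true, if_false, zero_ne_one, one_ne_zero, zero_smul, add_zero, ρfun_E] at h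
  have h' := DFunLike.congr_fun h ⟨(n, m, 1), h1⟩
  simp (disch := omega) only [LinearMap.add_apply, LinearMap.smul_apply, Module.End.one_apply, map_add, map_smul,
    map_neg, map_zero, smul_zero, Ha_vec, Hb_vec, Xa_vec, Ya_vec, Xab_vec, Xb_vec, Yab_vec, Yb_vec, vec_of_not_range,
    smul_add, smul_neg, smul_smul, neg_smul, neg_neg, sub_add_cancel, add_sub_cancel_right, Int.cast_add, Int.cast_sub,
    Int.cast_one, Int.cast_ofNat, add_zero, zero_add, Finsupp.add_apply, Finsupp.smul_apply, Finsupp.neg_apply,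
    vec_apply_mk, smul_eq_mul, mul_one, mul_zero, one_mul, and_true, true_and, if_true, if_neg] at h'
  rw [casimirScalar]
  linear_combination (-1 : ℂ) * h'

/-! ## §3 The vertex packages -/

/-- **LEVEL-ONE PACKAGE.**  At a `K`-type `(1, m)` (no `K`-type has dimension `0`, so the downward products vanish): (b20) reads `−A D′ + B C′ = m∕2`,
the Casimir scalar is `c_{1,m} = m²∕6 + 2(A D′ + B C′)`, hence `A D′ = (c_{1,m} − m²∕6 − m)∕4`, `B C′ = (c_{1,m} − m²∕6 + m)∕4`, and the cubic scalar is
`s = −m³∕36 + (c_{1,m} − m²∕6)(6−m)∕4 + m²∕4 − m∕2 + e·c_{1,m} + e³∕9`. [cite: Kovacevic2021, §3 Thm 2 (b20), Remark 3] [cite: Iachello2015, (7.24)] -/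
theorem cubicScalar_ofRecord_levelOne (𝒟 : SU21Datum) (e : ℤ) {s : ℂ} (hs : HasCubicScalar (σOfRecord 𝒟 e) s) {m : ℤ}
    (hS : ((1 : ℤ), m) ∈ 𝒟.S) :
    𝒟.A 1 m * 𝒟.D (1 + 1) (m + 3) = (𝒟.casimirScalar 1 m - (m : ℂ) ^ 2 / 6 - m) / 4 ∧
      𝒟.B 1 m * 𝒟.C (1 + 1) (m - 3) = (𝒟.casimirScalar 1 m - (m : ℂ) ^ 2 / 6 + m) / 4 ∧
      s = -(m : ℂ) ^ 3 / 36 + (𝒟.casimirScalar 1 m - (m : ℂ) ^ 2 / 6) * (6 - m) / 4 + (m : ℂ) ^ 2 / 4 - m / 2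
        + (e : ℂ) * 𝒟.casimirScalar 1 m + (e : ℂ) ^ 3 / 9 := by
  have hcub := cubicScalar_ofRecord_eq 𝒟 e hs hS
  have hA0 : 𝒟.A (1 - 1) (m - 3) = 0 := 𝒟.A_eq_zero fun h => by have := 𝒟.one_le_of_mem h; omega
  have hB0 : 𝒟.B (1 - 1) (m + 3) = 0 := 𝒟.B_eq_zero fun h => by have := 𝒟.one_le_of_mem h; omega
  have e20 := 𝒟.rel20 hS
  have hcas : 𝒟.casimirScalar 1 m = ((1 : ℤ) : ℂ) ^ 2 / 2 - 1 / 2 + (m : ℂ) ^ 2 / 6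
      + (((1 : ℤ) : ℂ) + 1) * (𝒟.A 1 m * 𝒟.D (1 + 1) (m + 3) + 𝒟.B 1 m * 𝒟.C (1 + 1) (m - 3))
      + (((1 : ℤ) : ℂ) - 1) * (𝒟.D 1 m * 𝒟.A (1 - 1) (m - 3) + 𝒟.C 1 m * 𝒟.B (1 - 1) (m + 3)) := by
    rw [casimirScalar]; ring
  rw [hA0, hB0] at hcas hcub
  rw [Int.cast_one] at e20 hcas hcub
  refine ⟨?_, ?_, ?_⟩
  · linear_combination (-1 / 2 : ℂ) * e20 + (-1 / 4 : ℂ) * hcas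
  · linear_combination (1 / 2 : ℂ) * e20 + (-1 / 4 : ℂ) * hcas
  · linear_combination hcub + ((m : ℂ) / 2 - 1) * e20 + (((m : ℂ) - 6) / 4) * hcas

/-- **LOCAL-MINIMUM PACKAGE (`n ≥ 2`).**  At a `K`-type `(n, m)`, `n ≥ 2`, with no `K`-type at either lower neighbour `(n−1, m∓3)` the downward products
vanish and (b20), (b25) are a Cramer system for the upward ones: `(n+1)·A D′ = −(n+m+1)∕2`, `(n+1)·B C′ = −(n−m+1)∕2`; consequently
`c_{n,m} = (n²−1)∕2 + m²∕6 − (n+1)` and `36 s = −81 + 9m + 9m² − m³ − 54n + 27n² − 18mn + 9mn² + 36e·c_{n,m} + 4e³` (the coefficients of `A D′`, `B C′` in §2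
carry the factor `n+1`, so no division is needed). [cite: Kovacevic2021, §3 Thm 2 (b20), (b25), proof of Thm 3] [cite: Iachello2015, (7.24)] -/
theorem localMin_package (𝒟 : SU21Datum) (e : ℤ) {s : ℂ} (hs : HasCubicScalar (σOfRecord 𝒟 e) s) {n m : ℤ}
    (hS : (n, m) ∈ 𝒟.S) (hD : (n - 1, m - 3) ∉ 𝒟.S) (hC : (n - 1, m + 3) ∉ 𝒟.S) (hn : 2 ≤ n) :
    ((n : ℂ) + 1) * (𝒟.A n m * 𝒟.D (n + 1) (m + 3)) = -((n : ℂ) + m + 1) / 2 ∧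
      ((n : ℂ) + 1) * (𝒟.B n m * 𝒟.C (n + 1) (m - 3)) = -((n : ℂ) - m + 1) / 2 ∧
      𝒟.casimirScalar n m = ((n : ℂ) ^ 2 - 1) / 2 + (m : ℂ) ^ 2 / 6 - (n + 1) ∧
      36 * s = -81 + 9 * (m : ℂ) + 9 * (m : ℂ) ^ 2 - (m : ℂ) ^ 3 - 54 * n + 27 * (n : ℂ) ^ 2 - 18 * (m : ℂ) * n
        + 9 * (m : ℂ) * (n : ℂ) ^ 2 + 36 * (e : ℂ) * (((n : ℂ) ^ 2 - 1) / 2 + (m : ℂ) ^ 2 / 6 - (n + 1)) + 4 * (e : ℂ) ^ 3 := by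
  have hcub := cubicScalar_ofRecord_eq 𝒟 e hs hS
  have hA0 : 𝒟.A (n - 1) (m - 3) = 0 := 𝒟.A_eq_zero hD
  have hB0 : 𝒟.B (n - 1) (m + 3) = 0 := 𝒟.B_eq_zero hC
  have e20 := 𝒟.rel20 hS
  have e25 := 𝒟.rel25 hS
  have hcas : 𝒟.casimirScalar n m = ((n : ℂ) ^ 2 - 1) / 2 + (m : ℂ) ^ 2 / 6
      + ((n : ℂ) + 1) * (𝒟.A n m * 𝒟.D (n + 1) (m + 3) + 𝒟.B n m * 𝒟.C (n + 1) (m - 3))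
      + ((n : ℂ) - 1) * (𝒟.D n m * 𝒟.A (n - 1) (m - 3) + 𝒟.C n m * 𝒟.B (n - 1) (m + 3)) := by
    rw [casimirScalar]
  rw [hA0, hB0] at hcas hcub
  rw [hB0] at e20
  rw [hA0] at e25
  have hn1 : (n : ℂ) - 1 ≠ 0 := by
    have : (n - 1 : ℤ) ≠ 0 := by omega
    exact_mod_cast this
  -- Cramer: `(n² − 1) X = (n − 1) · (…)`, then cancel `n − 1`
  have hP : ((n : ℂ) + 1) * (𝒟.A n m * 𝒟.D (n + 1) (m + 3)) = -((n : ℂ) + m + 1) / 2 := by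
    have h3 : ((n : ℂ) - 1) * (((n : ℂ) + 1) * (𝒟.A n m * 𝒟.D (n + 1) (m + 3)) + ((n : ℂ) + m + 1) / 2) = 0 := by
      linear_combination e20 - (n : ℂ) * e25
    have := (mul_eq_zero.1 h3).resolve_left hn1
    linear_combination this
  have hQ : ((n : ℂ) + 1) * (𝒟.B n m * 𝒟.C (n + 1) (m - 3)) = -((n : ℂ) - m + 1) / 2 := by
    have h3 : ((n : ℂ) - 1) * (((n : ℂ) + 1) * (𝒟.B n m * 𝒟.C (n + 1) (m - 3)) + ((n : ℂ) - m + 1) / 2) = 0 := by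
      linear_combination (n : ℂ) * e20 - e25
    have := (mul_eq_zero.1 h3).resolve_left hn1
    linear_combination this
  have hK : 𝒟.casimirScalar n m = ((n : ℂ) ^ 2 - 1) / 2 + (m : ℂ) ^ 2 / 6 - (n + 1) := by
    linear_combination hcas + hP + hQ
  refine ⟨hP, hQ, hK, ?_⟩
  linear_combination 36 * hcub + (18 * ((n : ℂ) + 3 - m)) * hP - (36 * ((n : ℂ) - 2)) * hQ + (36 * (e : ℂ)) * hK

/-! ## §4 χ ⇒ the Casimir scalar of the datum -/

/-- **χ-SCALARS OF THE RECORD DETERMINE THE CASIMIR SCALAR OF THE DATUM.**  For an irreducible datum the Casimir `Ω = Σ ρ(E_{ij})ρ(E_{ji})` is a scalar `κ₁`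
(★ `exists_casimir_eq_smul_one_of_isIrreducible`); by ★ `twistChiScalars` the trace-form Casimir of `σOfRecord 𝒟 e` is then `κ₁ + e²∕3`, and ★ `HasChiScalars`
says it is `κ`; comparing on a basis vector, `c_{n,m} = κ₁ = κ − e²∕3` on `S`. [cite: BorelWallach2000, II §2.5; II Prop. 6.12 (2)] [cite: Rogawski1990, §12.3 p. 177] -/
theorem casimirScalar_eq_of_hasChiScalars (𝒟 : SU21Datum) (hirr : LieModule.IsIrreducible ℂ (Matrix (Fin 3) (Fin 3) ℂ) 𝒟.V) {κ e : ℤ}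
    (hχ : HasChiScalars (σOfRecord 𝒟 e) κ e) {n m : ℤ} (hS : (n, m) ∈ 𝒟.S) :
    𝒟.casimirScalar n m = (κ : ℂ) - (e : ℂ) ^ 2 / 3 := by
  haveI := hirr
  obtain ⟨κ₁, hκ₁⟩ := 𝒟.exists_casimir_eq_smul_one_of_isIrreducible
  have hsum : ∀ v : 𝒟.V, (∑ i : Fin 3, ∑ j : Fin 3, ⁅E i j, ⁅E j i, v⁆⁆) = κ₁ • v := fun v => by
    rw [sum_lie_lie_eq_casimir, hκ₁, LinearMap.smul_apply, Module.End.one_apply]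
  have htw := (K2E1bTwistChiScalars.twistChiScalars 𝒟 e κ₁ hsum (σOfRecord 𝒟 e) (σOfRecord_isTwistOf 𝒟 e)).1 (𝒟.vec n m 1)
  have hv := 𝒟.vec_ne_zero ⟨hS, le_rfl, 𝒟.one_le_of_mem hS⟩
  rw [hχ.1 (𝒟.vec n m 1)] at htw
  have hκ : ((κ : ℤ) : ℂ) = κ₁ + (e : ℂ) ^ 2 / 3 := smul_left_injective ℂ hv htw
  rw [K2E1bDSCellData.casimirScalar_eq_of_casimir_eq_smul hκ₁ hS]
  linear_combination -hκ

/-! ## §5 Calibration: the cubic pin of the record cells IS `cubicOf a b c` -/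

section Regular

variable {a b c : ℤ}

/-- The cubic pin of the class of record `dsClsOfRecord a b c j`, moved onto the structure of record of the cell datum ★ `dsCellDatum j a b c` (★
`dsClsOfRecord_of_regular`: the class is that of ★ `dsCellRep`, whose `ρ𝔤` IS `σOfRecord (dsCellDatum j a b c) (centralOf a b c)`; ★ `hasCubicPin_mk_iff`: any
representative computes the pin). [cite: KnappVogan1995, §II.4] [cite: Rogawski1990, §12.3 p. 178] -/
theorem hasCubicScalar_dsCellDatum_of_hasCubicPin (h : IsRegularParam a b c) (j : Fin 3) {s : ℂ}
    (hs : HasCubicPin (dsClsOfRecord a b c j) s) : HasCubicScalar (σOfRecord (dsCellDatum j a b c) (centralOf a b c)) s := by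
  rw [dsClsOfRecord_of_regular h j] at hs
  exact (hasCubicPin_mk_iff _ s).1 hs

/-- Calibration of `D_φ` (`j = 0`): its local-minimum vertex `(a−c+1, a+c−2b)` (★ `dsCellDatum_vertex_zero`, `n = a−c+1 ≥ 5`) and §3's
`localMin_package`. [cite: Iachello2015, (7.24)] [cite: Rogawski1990, §12.3 p. 177] -/
theorem eq_cubicOf_of_hasCubicPin_dsClsOfRecord_zero (h : IsRegularParam a b c) {s : ℂ}
    (hs : HasCubicPin (dsClsOfRecord a b c 0) s) : s = ((cubicOf a b c : ℤ) : ℂ) := by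
  have hσ := hasCubicScalar_dsCellDatum_of_hasCubicPin h 0 hs
  obtain ⟨h1, h2⟩ := id h
  obtain ⟨hv, hvD, hvC, -⟩ := K2E1bDSCellData.dsCellDatum_vertex_zero h
  obtain ⟨-, -, hK, hG⟩ := localMin_package _ _ hσ hv hvD hvC (by omega)
  rw [K2E1bDSCellData.dsCellDatum_casimirScalar 0 hv] at hK
  rw [← hK] at hG
  push_cast [cubicOf, casimirOf, centralOf] at hG ⊢
  linear_combination (1 / 36 : ℂ) * hG

/-- Calibration of `D_φ⁺` (`j = 1`): its cone vertex `(1, 2t⁺)` (★ `dsCellDatum_coneVertex_one`) and §3's level-one package.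
[cite: Iachello2015, (7.24)] [cite: Rogawski1990, §12.3 p. 177] -/
theorem eq_cubicOf_of_hasCubicPin_dsClsOfRecord_one (h : IsRegularParam a b c) {s : ℂ}
    (hs : HasCubicPin (dsClsOfRecord a b c 1) s) : s = ((cubicOf a b c : ℤ) : ℂ) := by
  have hσ := hasCubicScalar_dsCellDatum_of_hasCubicPin h 1 hs
  obtain ⟨hv, -, -⟩ := K2E1bDSCellData.dsCellDatum_coneVertex_one h
  obtain ⟨-, -, hG⟩ := cubicScalar_ofRecord_levelOne _ _ hσ hv
  rw [K2E1bDSCellData.dsCellDatum_casimirScalar 1 hv] at hG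
  push_cast [cubicOf, casimirOf, centralOf, tPlus] at hG ⊢
  linear_combination hG

/-- Calibration of `D_φ⁻` (`j = 2`): its cone vertex `(1, 2t⁻)` (★ `dsCellDatum_coneVertex_two`) and §3's level-one package.
[cite: Iachello2015, (7.24)] [cite: Rogawski1990, §12.3 p. 177] -/
theorem eq_cubicOf_of_hasCubicPin_dsClsOfRecord_two (h : IsRegularParam a b c) {s : ℂ}
    (hs : HasCubicPin (dsClsOfRecord a b c 2) s) : s = ((cubicOf a b c : ℤ) : ℂ) := by
  have hσ := hasCubicScalar_dsCellDatum_of_hasCubicPin h 2 hs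
  obtain ⟨hv, -, -⟩ := K2E1bDSCellData.dsCellDatum_coneVertex_two h
  obtain ⟨-, -, hG⟩ := cubicScalar_ofRecord_levelOne _ _ hσ hv
  rw [K2E1bDSCellData.dsCellDatum_casimirScalar 2 hv] at hG
  push_cast [cubicOf, casimirOf, centralOf, tMinus] at hG ⊢
  linear_combination hG

/-- **CALIBRATION (uniqueness half of LAWS row U8-4c (iii)).**  At a regular parameter, a cubic pin `s` of the record class `dsClsOfRecord a b c j` equals the
Perelomov–Popov value `cubicOf a b c = a³+b³+c³ + (a²+b²+c²−ab−bc−ca) − 2(a+b+c) − 3` for each `j`: by §3 at the cell's vertex — `D_φ`: local minimum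
`(a−c+1, a+c−2b)` (★ `dsCellDatum_vertex_zero`), `D_φ^±`: cone vertex `(1, 2t^±)` (★ `dsCellDatum_coneVertex_one∕two`) — with the cell's Casimir scalar
`κ − e²∕3` (★ `dsCellDatum_casimirScalar`), the value is a polynomial identity in `a, b, c`. [cite: Iachello2015, (7.20)–(7.24)] [cite: Molev2007, Thm. 7.1.1]
[cite: Rogawski1990, §12.3 pp. 176–178] -/
theorem eq_cubicOf_of_hasCubicPin_dsClsOfRecord (h : IsRegularParam a b c) (j : Fin 3) {s : ℂ}
    (hs : HasCubicPin (dsClsOfRecord a b c j) s) : s = ((cubicOf a b c : ℤ) : ℂ) := by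
  fin_cases j
  · exact eq_cubicOf_of_hasCubicPin_dsClsOfRecord_zero h hs
  · exact eq_cubicOf_of_hasCubicPin_dsClsOfRecord_one h hs
  · exact eq_cubicOf_of_hasCubicPin_dsClsOfRecord_two h hs

end Regular

end Summit.HodgeConjecture.HodgeConjecture.Cruxes.H413.K2E1bDatumCubicScalar

end
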